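import Mathlib
import HarnessLib
import Summits.NavierStokesRegularity.NavierStokesRegularity.Theses.ExtremalTypeIConstant
import Summits.NavierStokesRegularity.NavierStokesRegularity.Theorems.ExtremalTypeIConstantMinimiserExists
import Summits.NavierStokesRegularity.NavierStokesRegularity.Theorems.ExtremalTypeIConstantTargetOfCruxes

/-!
# Crux `ExtremalSpiralSymmetry` (stmt-NavierStokesRegularity-8215), line `registered` — the ROUTE IDENTITY
# `TypeIAncientLiouville ↔ (ExtremalSpiralSymmetry ∧ SpiralScalingLiouville)`

Support file (theorems only, `--supports stmt-NavierStokesRegularity-8215`; no definitions, no named facts). Lead c4.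

Write `X = TypeIAncientLiouville` (route target, stmt-4050), `ESS = ExtremalSpiralSymmetry` (this crux, stmt-8215)
and `SSL = SpiralScalingLiouville` (crux 3 of the route, stmt-8216). The route's glue `TargetOfCruxes`
(`ESS → SSL → MinimiserExists → X`, p-landed as `extremalTypeIConstant_targetOfCruxes_proof`) and the PROVED support
`MinimiserExists` (stmt-8217, `extremalTypeIConstant_minimiserExists_proof`) give `ESS ∧ SSL → X`; conversely `X`
gives `ESS` VACUOUSLY (an extremal pair has `‖u(−1,0)‖ = C > 0`, impossible when every element of `A_C` vanishes)
and `SSL` DIRECTLY (`X` kills every element of the class, symmetric or not). Hence, unconditionally and by pure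
logic over landed theorems:

* `typeIAncientLiouville_iff_extremalSpiralSymmetry_and_spiralScalingLiouville` — `X ↔ (ESS ∧ SSL)`: the two OPEN
  cruxes of route `ExtremalTypeIConstant` are JOINTLY EQUIVALENT to its target;
* `extremalSpiralSymmetry_iff_typeIAncientLiouville_of_spiralScalingLiouville` — `SSL → (ESS ↔ X)`: modulo crux 3
  this crux IS the target. This sharpens lead c3's certificate
  `extremalSpiralSymmetry_iff_typeIAncientLiouville_of_rdssLiouvilleInClass` (hypothesis: the RDSS wall stmt-8561),
  since stmt-8561 implies `SSL` (`spiralScalingLiouville_of_rdssLiouvilleInClass`, p154081) but not conversely in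
  tree;
* `spiralScalingLiouville_iff_typeIAncientLiouville_of_extremalSpiralSymmetry` — `ESS → (SSL ↔ X)`, the symmetric
  statement for crux 3.

Reading for the planner: neither open crux of this route can be closed without closing the target itself unless
the OTHER crux is used; `ESS` alone is implied by `X` and is new mathematics otherwise (Conjecture M's recurrence
half, see `…NoSlack.lean`). Nothing here asserts `X`, `ESS` or `SSL`.
-/

-- the summit and its single sub-problem share the name (CONVENTIONS §1), as in every Theorems file
set_option linter.dupNamespace false

namespace Summit.NavierStokesRegularity.NavierStokesRegularity.Theorems.ExtremalSpiralSymmetry.Registered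

open _root_.Summit.NavierStokesRegularity.NavierStokesRegularity.Theses.ExtremalTypeIConstant
open _root_.Summit.NavierStokesRegularity.NavierStokesRegularity.Theorems

/-- **The target implies the crux, vacuously.** Under `X = TypeIAncientLiouville` every element of `A_C` vanishes
on `t < 0`, so no extremal pair (which has `‖u(−1,0)‖ = C > 0`) exists. [folklore: pure logic] -/
theorem extremalSpiralSymmetry_of_typeIAncientLiouville (hX : TypeIAncientLiouville) :
    ExtremalSpiralSymmetry := by
  intro C u hC hext
  exfalso
  have h0 : u (-1) 0 = 0 := hX C u hext.1 (-1) (by norm_num) 0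
  have h1 := hext.2.1
  rw [h0, norm_zero] at h1
  exact absurd h1.symm hC.ne'

/-- **The target implies crux 3, directly.** Under `X` every element of `A_C` vanishes on `t < 0`, in particular
every element carrying a spiral-scaling generator. [folklore: pure logic] -/
theorem spiralScalingLiouville_of_typeIAncientLiouville (hX : TypeIAncientLiouville) :
    SpiralScalingLiouville := by
  intro C u hu _ t ht x
  exact hX C u hu t ht x

/-- **The two cruxes imply the target** (`TargetOfCruxes` fed with the proved `MinimiserExists`).
[folklore: pure logic; Merle-type template doi:10.1215/s0012-7094-93-06919-0 over the KNSS class arXiv:0709.3599] -/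
theorem typeIAncientLiouville_of_extremalSpiralSymmetry_of_spiralScalingLiouville
    (hESS : ExtremalSpiralSymmetry) (hSSL : SpiralScalingLiouville) : TypeIAncientLiouville :=
  extremalTypeIConstant_targetOfCruxes_proof hESS hSSL extremalTypeIConstant_minimiserExists_proof

/-- **Route identity: the target is equivalent to the conjunction of the two open cruxes.**
`X ↔ (ExtremalSpiralSymmetry ∧ SpiralScalingLiouville)`. UNCONDITIONAL. [folklore: pure logic] -/
theorem typeIAncientLiouville_iff_extremalSpiralSymmetry_and_spiralScalingLiouville :
    _root_.Summit.NavierStokesRegularity.NavierStokesRegularity.Theses.ExtremalTypeIConstant.TypeIAncientLiouville ↔ (_root_.Summit.NavierStokesRegularity.NavierStokesRegularity.Theses.ExtremalTypeIConstant.ExtremalSpiralSymmetry ∧ _root_.Summit.NavierStokesRegularity.NavierStokesRegularity.Theses.ExtremalTypeIConstant.SpiralScalingLiouville) :=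
  ⟨fun hX => ⟨extremalSpiralSymmetry_of_typeIAncientLiouville hX,
      spiralScalingLiouville_of_typeIAncientLiouville hX⟩,
    fun h => typeIAncientLiouville_of_extremalSpiralSymmetry_of_spiralScalingLiouville h.1 h.2⟩

/-- **No slack modulo crux 3: given `SpiralScalingLiouville`, this crux IS the route target.**
CONDITIONAL on stmt-8216 (hypothesis); the hypothesis is implied by the RDSS wall stmt-8561
(`spiralScalingLiouville_of_rdssLiouvilleInClass`). [folklore: pure logic] -/
theorem extremalSpiralSymmetry_iff_typeIAncientLiouville_of_spiralScalingLiouville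
    (hSSL : SpiralScalingLiouville) : ExtremalSpiralSymmetry ↔ TypeIAncientLiouville :=
  ⟨fun hESS => typeIAncientLiouville_of_extremalSpiralSymmetry_of_spiralScalingLiouville hESS hSSL,
    extremalSpiralSymmetry_of_typeIAncientLiouville⟩

/-- **Symmetrically: given this crux, crux 3 IS the route target.** CONDITIONAL on stmt-8215 (hypothesis).
[folklore: pure logic] -/
theorem spiralScalingLiouville_iff_typeIAncientLiouville_of_extremalSpiralSymmetry
    (hESS : ExtremalSpiralSymmetry) : SpiralScalingLiouville ↔ TypeIAncientLiouville :=
  ⟨fun hSSL => typeIAncientLiouville_of_extremalSpiralSymmetry_of_spiralScalingLiouville hESS hSSL,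
    spiralScalingLiouville_of_typeIAncientLiouville⟩

end Summit.NavierStokesRegularity.NavierStokesRegularity.Theorems.ExtremalSpiralSymmetry.Registered
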